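import Mathlib
import Summits.MatrixMultiplication.MatrixMultiplication.Theses.FidelityWitnesses
import Literature.Computability.AlgebraicComplexity.BorderRankLimit

/-!
# `FidelityWitnesses.GapImpliesBorderRank` (stmt-MatrixMultiplication-4961) — proved

Soundness of fidelity witnesses for the tree's ALGEBRAIC border rank `algBorderRank`
(Bläser 2013, Def. 6.1 = Bürgisser–Clausen–Shokrollahi 1997, Def. (15.19)): for a nonzero tensor
`T` over finite index types, a uniform fidelity gap
`‖Σ conj(S)·T‖² ≤ (1 − ε)·‖S‖²·‖T‖²` on all tensors `S` of rank `≤ r` forces `r < algBorderRank T`.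

Proof.  If `algBorderRank T ≤ r`, the elementary half of the topological characterisation of border
rank (`mem_closure_setOf_tensorRank_le_of_algBorderRank_le`, `BorderRankLimit.lean`: evaluate an
order-`h` approximate decomposition at `θ ≠ 0` and divide by `θ^h`) puts `T` in the closure of the
rank-`≤ r` tensors.  The gap set `{S | ‖Σ conj(S)·T‖² ≤ (1 − ε)·‖S‖²·‖T‖²}` is closed (both sides
are continuous in `S`) and contains the rank-`≤ r` tensors, hence their closure, hence `T` itself;
at `S = T` this reads `N² ≤ (1 − ε)·N²` with `N = Σ‖T_abc‖² > 0`, absurd.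
-/

namespace Summit.MatrixMultiplication.MatrixMultiplication.Theorems

open scoped BigOperators ComplexConjugate
open Literature.Computability.AlgebraicComplexity

/-- **Soundness of fidelity witnesses** (item `stmt-MatrixMultiplication-4961`): for `T ≠ 0` over
finite index types, a fidelity gap `ε > 0` on all rank-`≤ r` tensors forces `r < algBorderRank T`
(a border-rank-`≤ r` tensor is a limit of rank-`≤ r` tensors, BCS 1997 §15.4 / Bläser 2013 Def. 6.1,
and the gap inequality is a closed condition violated at `S = T`). [folklore] -/
theorem gapImpliesBorderRank_proof :
    Summit.MatrixMultiplication.MatrixMultiplication.Theses.FidelityWitnesses.GapImpliesBorderRank := by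
  unfold Summit.MatrixMultiplication.MatrixMultiplication.Theses.FidelityWitnesses.GapImpliesBorderRank
  intro ι κ μ _ _ _ T r hT hgap
  obtain ⟨ε, hε, hgap⟩ := hgap
  by_contra hle
  rw [not_lt] at hle
  classical
  -- (1) border rank `≤ r` ⟹ `T` is a limit of rank-`≤ r` tensors (fact-free, tree)
  have hmem : T ∈ closure {S : ι → κ → μ → ℂ | tensorRank S ≤ r} :=
    mem_closure_setOf_tensorRank_le_of_algBorderRank_le hle
  -- (2) the gap set is closed and contains `{rank ≤ r}`, hence its closure, hence `T`
  have hcont₁ : Continuous fun S : ι → κ → μ → ℂ =>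
      ‖∑ a, ∑ b, ∑ c, (starRingEnd ℂ) (S a b c) * T a b c‖ ^ 2 := by
    refine (continuous_finsetSum _ fun a _ => continuous_finsetSum _ fun b _ =>
      continuous_finsetSum _ fun c _ => ?_).norm.pow 2
    exact (Complex.continuous_conj.comp
      ((continuous_apply c).comp ((continuous_apply b).comp (continuous_apply a)))).mul
      continuous_const
  have hcont₂ : Continuous fun S : ι → κ → μ → ℂ =>
      (1 - ε) * (∑ a, ∑ b, ∑ c, ‖S a b c‖ ^ 2) * (∑ a, ∑ b, ∑ c, ‖T a b c‖ ^ 2) := by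
    fun_prop
  have hclosed : IsClosed {S : ι → κ → μ → ℂ |
      ‖∑ a, ∑ b, ∑ c, (starRingEnd ℂ) (S a b c) * T a b c‖ ^ 2 ≤
        (1 - ε) * (∑ a, ∑ b, ∑ c, ‖S a b c‖ ^ 2) * (∑ a, ∑ b, ∑ c, ‖T a b c‖ ^ 2)} :=
    isClosed_le hcont₁ hcont₂
  have hsub : closure {S : ι → κ → μ → ℂ | tensorRank S ≤ r} ⊆ {S : ι → κ → μ → ℂ |
      ‖∑ a, ∑ b, ∑ c, (starRingEnd ℂ) (S a b c) * T a b c‖ ^ 2 ≤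
        (1 - ε) * (∑ a, ∑ b, ∑ c, ‖S a b c‖ ^ 2) * (∑ a, ∑ b, ∑ c, ‖T a b c‖ ^ 2)} :=
    hclosed.closure_subset_iff.mpr fun S hS => hgap S hS
  have key := hsub hmem
  simp only [Set.mem_setOf_eq] at key
  -- (3) at `S = T`: `N² ≤ (1 - ε) N²` with `N = Σ ‖T_abc‖² > 0`
  set N : ℝ := ∑ a, ∑ b, ∑ c, ‖T a b c‖ ^ 2 with hN
  have hinner : (∑ a, ∑ b, ∑ c, (starRingEnd ℂ) (T a b c) * T a b c) = ((N : ℝ) : ℂ) := by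
    rw [hN]
    push_cast
    refine Finset.sum_congr rfl fun a _ => Finset.sum_congr rfl fun b _ =>
      Finset.sum_congr rfl fun c _ => ?_
    exact Complex.conj_mul' (T a b c)
  have hnormN : ‖((N : ℝ) : ℂ)‖ ^ 2 = N ^ 2 := by
    rw [Complex.norm_real, Real.norm_eq_abs, sq_abs]
  rw [hinner, hnormN] at key
  have hNpos : 0 < N := by
    obtain ⟨a, b, c, habc⟩ : ∃ a b c, T a b c ≠ 0 := by
      by_contra h
      push Not at h
      exact hT (funext fun a => funext fun b => funext fun c => h a b c)
    have h1 : ‖T a b c‖ ^ 2 ≤ ∑ c', ‖T a b c'‖ ^ 2 :=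
      Finset.single_le_sum (f := fun c' => ‖T a b c'‖ ^ 2) (fun _ _ => by positivity)
        (Finset.mem_univ c)
    have h2 : (∑ c', ‖T a b c'‖ ^ 2) ≤ ∑ b', ∑ c', ‖T a b' c'‖ ^ 2 :=
      Finset.single_le_sum (f := fun b' => ∑ c', ‖T a b' c'‖ ^ 2) (fun _ _ => by positivity)
        (Finset.mem_univ b)
    have h3 : (∑ b', ∑ c', ‖T a b' c'‖ ^ 2) ≤ N :=
      Finset.single_le_sum (f := fun a' => ∑ b', ∑ c', ‖T a' b' c'‖ ^ 2)
        (fun _ _ => by positivity) (Finset.mem_univ a)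
    have h0 : 0 < ‖T a b c‖ ^ 2 := by positivity
    linarith
  nlinarith [mul_pos hε (mul_pos hNpos hNpos)]

end Summit.MatrixMultiplication.MatrixMultiplication.Theorems
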